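import Literature.NumberTheory.GaloisRepresentations.LubinTateColemanCoordCoinvariantTwistTwo
import HarnessLib

/-!
# The COSET extension of de Shalit's cocycle (II §2.4 (ii), §4.12) when the decomposition group `D` has finite index in `G`: from the `D`-indexed
# family `x` with `φ(x_𝔞) = (s_𝔞 − N𝔞)·L` and ONE elliptic unit `y = e(𝔟)_𝔓` of a non-liftable class, the conjugate family
# `x′_𝔞 := N𝔟·x_𝔞 + (𝒯_𝔞 − N𝔞)·y` (= `(σ_𝔟 e(𝔞))_𝔓`) is again a `D`-cocycle with constant `L′ = N𝔟·L + φ(y)`, and the `χ`-averaged family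
# `x_𝔞 + Σ_t χ_t·δ_t(x′_{t,𝔞})` has `φ = (s_𝔞 − N𝔞)·μ_χ`, `μ_χ = L + Σ_t χ_t s_{δ_t}(N𝔟_t·L + φ(y_t))` — generic over a linear functional, then for `φ_ε`

De Shalit, *Iwasawa theory of elliptic curves with complex multiplication* (1987), II §2.4 (ii) (`e(𝔞)^{σ_𝔟 − N𝔟} = e(𝔟)^{σ_𝔞 − N𝔞}` for ALL `𝔞, 𝔟`),
II §4.12 (29)–(33) (`μ_𝔞 = (σ_𝔞 − N𝔞)·μ` on `𝒢`, `i` SEMI-local), III §1.3–1.4 (`U = ∏_{𝔓∣𝔭} U_𝔓`, `i(𝒞̄) = μ·Λ₀`).  The tree's (c)-capstone works at ONE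
prime `𝔓` with the ideals whose Artin symbol lies in the decomposition group `D` ("liftable", `IsLocArtinLiftable`), obtaining the `D`-component `L` of
`μ` (`colemanDeltaCoinvFun_eq_mul_of_divides`: `φ_ε(x_𝔠) = (t_𝔠 − N𝔠)·L`).  When `[G:D] > 1` (e.g. `K = ℚ(√−7)`, `𝔤 = (√−7)v̄³`: index `2`, memo
BRICK-C-PADIC-g20 F26) the `χ`-coinvariants of the SEMI-local module see, for each `e(𝔞)`, the `χ`-weighted sum over `G_tor/D_tor` of the `𝔓`-components
of its conjugates; II §2.4 (ii) expresses the conjugate `(σ_𝔟 e(𝔞))_𝔓` through `e(𝔟)_𝔓` and the `D`-action: `= N𝔟·e(𝔞)_𝔓 + (σ̃_𝔞 − N𝔞)e(𝔟)_𝔓`.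
THIS file is the resulting ALGEBRA (everything PROVED, 0 sorry, no definitions; hypotheses are exactly the shapes the elliptic-unit files provide):

* §1 (generic: `R`-module `M`, functional `φ : M →ₗ R`, a commuting family of `R`-linear operators `𝒯_a` with `φ ∘ 𝒯_a = s_a·φ`, norms `N_a`)
  `cocycleScalar_of_rel` (**`(s_c − N_c)φ(x_a) = (s_a − N_a)φ(x_c)`**), `eq_mul_of_divides` (division by a non-zero-divisor `s_{a₁} − N_{a₁}`),
  ★★ **`conj_rel`** — the conjugate family `x′_a := N_b • x_a + (𝒯_a y − N_a • y)` satisfies the SAME cocycle relation (formal, from commutativity),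
  ★★ **`apply_conj_eq`** — `φ(x′_a) = (s_a − N_a)·(N_b·L + φ y)` (no second division needed), ★★★ **`apply_add_sum_smul_eq`** — for operators `δ_t` with
  `φ ∘ δ_t = s′_t·φ` and signs `χ_t`: **`φ(x_a + Σ_t χ_t • δ_t(x′_{t,a})) = (s_a − N_a)·(L + Σ_t χ_t s′_t (N_{b_t} L + φ y_t))`** =: `(s_a − N_a)·μ_χ`,
  and `map_span_range_averaged_eq` (**`φ(span {averaged family}) = μ_χ · (ideal of the s_a − N_a)`** — III §1.4 (5) with cosets).
* §2 the Coleman coordinate module at `q = 2` (`φ = φ_ε`, `𝒯_a = σ_{v_a} ∘ (C g_a •)`, `s_a = t_{v_a}·C g_a`, `δ = σ_w ∘ (C h •)`):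
  `colemanDeltaCoinvFun_unitTwistₗ_smul` (`φ_ε(σ_v (g • m)) = (t_v g)·φ_ε(m)`), ★★ `colemanDeltaCoinvFun_conj_eq`, ★★★ `colemanDeltaCoinvFun_add_sum_smul_galTwist_eq`.

## References
* E. de Shalit, *Iwasawa theory of elliptic curves with complex multiplication* (1987), Ch. II §2.4 (ii), §4.12 (29)–(33); Ch. III §1.3, §1.4 (5), §1.8 (14). [deShalit1987]
* K. Rubin, Invent. Math. 103 (1991), §4 (`U(F) = ∏_{w∣𝔭}`, `(U/C)^χ`). [Rubin1991]
-/

noncomputable section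

open PowerSeries

namespace Literature.NumberTheory.GaloisRepresentations

/-! ### §1. Generic: cocycle families for a commuting family of operators with `φ`-multipliers -/

namespace CosetCocycle

variable {R M : Type*} [CommRing R] [AddCommGroup M] [Module R M] (φ : M →ₗ[R] R)
variable {I : Type*} (𝒯 : I → M →ₗ[R] M) (s N : I → R) (hφ : ∀ (a : I) (m : M), φ (𝒯 a m) = s a * φ m)

include hφ in
/-- `φ((𝒯_a − N_a) m) = (s_a − N_a)·φ(m)`. [cite: deShalit1987, Ch. II §4.12 (29)] -/
theorem apply_sub_smul (a : I) (m : M) : φ (𝒯 a m - N a • m) = (s a - N a) * φ m := by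
  rw [map_sub, map_smul, hφ, smul_eq_mul, sub_mul]

include hφ in
/-- ★ **The cocycle relation in `R`**: `𝒯_c(x_a) − N_c x_a = 𝒯_a(x_c) − N_a x_c` for all `a, c` ⟹ `(s_c − N_c)φ(x_a) = (s_a − N_a)φ(x_c)`.
[cite: deShalit1987, Ch. II §2.4 (ii), §4.12 (29)–(31)] -/
theorem cocycleScalar_of_rel (x : I → M) (hrel : ∀ a c : I, 𝒯 c (x a) - N c • x a = 𝒯 a (x c) - N a • x c) (a c : I) :
    (s c - N c) * φ (x a) = (s a - N a) * φ (x c) := by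
  rw [← apply_sub_smul φ 𝒯 s N hφ, ← apply_sub_smul φ 𝒯 s N hφ, hrel]

include hφ in
/-- ★ **Division** (II §4.12 (32)–(33)): if `φ(x_{a₁}) = (s_{a₁} − N_{a₁})·L` with `s_{a₁} − N_{a₁}` a non-zero-divisor, then `φ(x_c) = (s_c − N_c)·L` for all `c`.
[cite: deShalit1987, Ch. II §4.12 (32)–(33)] -/
theorem eq_mul_of_divides (x : I → M) (hrel : ∀ a c : I, 𝒯 c (x a) - N c • x a = 𝒯 a (x c) - N a • x c) (a₁ : I) (L : R)
    (hreg : s a₁ - N a₁ ∈ nonZeroDivisors R) (hL : φ (x a₁) = (s a₁ - N a₁) * L) (c : I) : φ (x c) = (s c - N c) * L := by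
  have h := cocycleScalar_of_rel φ 𝒯 s N hφ x hrel a₁ c
  rw [hL, ← mul_assoc, mul_comm (s c - N c), mul_assoc] at h
  exact (mul_cancel_left_mem_nonZeroDivisors hreg).mp h.symm

variable (hcomm : ∀ a c : I, 𝒯 a ∘ₗ 𝒯 c = 𝒯 c ∘ₗ 𝒯 a)

include hcomm in
/-- ★★ **The CONJUGATE family is again a cocycle family.**  For a cocycle family `x`, an element `y` and a scalar `N_b`, the family
`x′_a := N_b • x_a + (𝒯_a y − N_a • y)` — by II §2.4 (ii) this is `(σ_𝔟 e(𝔞))_𝔓` when `x_a = e(𝔞)_𝔓`, `y = e(𝔟)_𝔓` — satisfies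
`𝒯_c(x′_a) − N_c x′_a = 𝒯_a(x′_c) − N_a x′_c` (the operators commute). [cite: deShalit1987, Ch. II §2.4 (ii)] -/
theorem conj_rel (x : I → M) (hrel : ∀ a c : I, 𝒯 c (x a) - N c • x a = 𝒯 a (x c) - N a • x c) (y : M) (Nb : R) (a c : I) :
    𝒯 c (Nb • x a + (𝒯 a y - N a • y)) - N c • (Nb • x a + (𝒯 a y - N a • y)) =
      𝒯 a (Nb • x c + (𝒯 c y - N c • y)) - N a • (Nb • x c + (𝒯 c y - N c • y)) := by
  have hTc : 𝒯 c (𝒯 a y) = 𝒯 a (𝒯 c y) := by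
    have h := LinearMap.congr_fun (hcomm c a) y
    simpa using h
  have h1 : 𝒯 c (x a) = 𝒯 a (x c) - N a • x c + N c • x a := by rw [← hrel a c, sub_add_cancel]
  simp only [map_add, map_sub, map_smul, smul_add, smul_sub, h1, hTc]
  module

include hφ in
/-- ★★ **`φ(x′_a) = (s_a − N_a)·(N_b·L + φ(y))`** for the conjugate family, once `φ(x_a) = (s_a − N_a)·L`: the second coset component of the measure is
`L′ = N_b·L + φ(y)` — no second division is needed. [cite: deShalit1987, Ch. II §2.4 (ii), §4.12 (33)] -/
theorem apply_conj_eq (x : I → M) (L : R) (hx : ∀ c, φ (x c) = (s c - N c) * L) (y : M) (Nb : R) (a : I) :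
    φ (Nb • x a + (𝒯 a y - N a • y)) = (s a - N a) * (Nb * L + φ y) := by
  rw [map_add, map_smul, hx, apply_sub_smul φ 𝒯 s N hφ, smul_eq_mul]
  ring

include hφ in
/-- ★★★ **The `χ`-AVERAGED family has `φ = (s_a − N_a)·μ_χ`**: for finitely many cosets `t ∈ T` with operators `δ_t` (`φ ∘ δ_t = s′_t·φ`), signs `χ_t`, norms
`N_{b_t}` and elements `y_t`, **`φ(x_a + Σ_t χ_t • δ_t(N_{b_t} • x_a + (𝒯_a y_t − N_a • y_t))) = (s_a − N_a)·(L + Σ_t χ_t s′_t (N_{b_t} L + φ y_t))`**.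
[cite: deShalit1987, Ch. II §4.12 (29)–(33); Ch. III §1.3, §1.4 (5)] -/
theorem apply_add_sum_smul_eq (x : I → M) (L : R) (hx : ∀ c, φ (x c) = (s c - N c) * L) {T : Type*} (𝓣 : Finset T)
    (δ : T → M →ₗ[R] M) (s' : T → R) (hδ : ∀ (t : T) (m : M), φ (δ t m) = s' t * φ m) (χ : T → R) (Nb : T → R) (y : T → M) (a : I) :
    φ (x a + ∑ t ∈ 𝓣, χ t • δ t (Nb t • x a + (𝒯 a (y t) - N a • y t))) =
      (s a - N a) * (L + ∑ t ∈ 𝓣, χ t * s' t * (Nb t * L + φ (y t))) := by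
  rw [map_add, hx, map_sum, mul_add, Finset.mul_sum]
  refine congrArg _ (Finset.sum_congr rfl fun t _ => ?_)
  rw [map_smul, hδ, apply_conj_eq φ 𝒯 s N hφ x L hx, smul_eq_mul]
  ring

include hφ in
/-- **`φ` of the `R`-span of the averaged family is `μ_χ` times the ideal of the `s_a − N_a`** (III §1.4 (5) with cosets).
[cite: deShalit1987, Ch. III §1.4 (5); Ch. II §4.12 (33)] -/
theorem map_span_range_averaged_eq (x : I → M) (L : R) (hx : ∀ c, φ (x c) = (s c - N c) * L) {T : Type*} (𝓣 : Finset T)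
    (δ : T → M →ₗ[R] M) (s' : T → R) (hδ : ∀ (t : T) (m : M), φ (δ t m) = s' t * φ m) (χ : T → R) (Nb : T → R) (y : T → M) :
    (Submodule.span R (Set.range fun a => x a + ∑ t ∈ 𝓣, χ t • δ t (Nb t • x a + (𝒯 a (y t) - N a • y t)))).map φ =
      Ideal.span (Set.range fun a => (s a - N a) * (L + ∑ t ∈ 𝓣, χ t * s' t * (Nb t * L + φ (y t)))) := by
  have hfun : (⇑φ ∘ fun a => x a + ∑ t ∈ 𝓣, χ t • δ t (Nb t • x a + (𝒯 a (y t) - N a • y t))) =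
      fun a => (s a - N a) * (L + ∑ t ∈ 𝓣, χ t * s' t * (Nb t * L + φ (y t))) :=
    funext fun a => apply_add_sum_smul_eq φ 𝒯 s N hφ x L hx 𝓣 δ s' hδ χ Nb y a
  rw [Submodule.map_span, ← Set.range_comp, hfun]

end CosetCocycle

/-! ### §2. The Coleman coordinate module at `q = 2`: `𝒯_a = σ_{v_a} ∘ (C g_a •)`, `φ = φ_ε` -/

section Coleman

open GaloisRepresentations.IsNonarchimedeanLocalField LubinTate ValuativeRel

variable {F : Type} [Field F] [ValuativeRel F] [TopologicalSpace F] [IsNonarchimedeanLocalField F]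

attribute [local instance] ltNormUniformSpace ltNormIsUniformAddGroup rk1 nF nE fintypeResidueField

variable {π : 𝒪[F]} (hπ : (valuation F).IsUniformizer (π : F)) (hq : residueFieldCard F = 2)
variable {S : Type*} [CommRing S] (ι : LTCoeff F →+* S) [IsAdicComplete (Ideal.span {ι (LTCoeff.of F π)}) S]
variable (u : (LTCoeff F)ˣ) (hu : LTCoeff.of F π = residueFieldCard F * u) (γ : 𝒪[F]ˣ)
variable (hreg : ∀ x : S, ι (LTCoeff.of F π) * x = 0 → x = 0) (w : 𝒪[F]ˣ) (hγ : (γ : 𝒪[F]) = 1 + π ^ 2 * w)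
variable (ε : PowerSeries S) (hε : ε * ε = 1)

include hε in
/-- **`φ_ε(σ_v (g • m)) = (t_v·g)·φ_ε(m)`**: the Galois operator `σ_v ∘ (g •)` (Lubin–Tate twist after an Amice scalar `g ∈ Λ`) has `φ_ε`-multiplier
`t_v^ε·g`. [cite: deShalit1987, Ch. I §3.1, §3.4 Lemma (ii)] -/
theorem colemanDeltaCoinvFun_unitTwistₗ_smul (v : 𝒪[F]ˣ) (g : PowerSeries S) (m : ColemanCoordModule hπ hq ι u hu γ) :
    colemanDeltaCoinvFun hπ hq ι u hu γ hreg w hγ ε (unitTwistₗ hπ hq ι u hu γ v (g • m)) =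
      (colemanDeltaCoinvFun hπ hq ι u hu γ hreg w hγ ε (unitTwistₗ hπ hq ι u hu γ v (TActModule.ofPS _ _ 1)) * g) *
        colemanDeltaCoinvFun hπ hq ι u hu γ hreg w hγ ε m := by
  rw [colemanDeltaCoinvFun_unitTwistₗ hπ hq ι u hu γ hreg w hγ ε hε, map_smul, smul_eq_mul, mul_assoc]

include hε in
/-- ★★ **The conjugate component at one prime**: with `𝒯_a = σ_{v_a} ∘ (g_a •)` and `φ_ε(x_c) = (t_{v_c} g_c − N_c)·L` for all `c` (the (c)-capstone's
`hL`), the conjugate family `x′_a := N_b • x_a + (σ_{v_a}(g_a • y) − N_a • y)` has **`φ_ε(x′_a) = (t_{v_a} g_a − N_a)·(N_b·L + φ_ε(y))`**.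
[cite: deShalit1987, Ch. II §2.4 (ii), §4.12 (33)] -/
theorem colemanDeltaCoinvFun_conj_eq {I : Type*} (x : I → ColemanCoordModule hπ hq ι u hu γ) (v : I → 𝒪[F]ˣ) (g N : I → PowerSeries S)
    (L : PowerSeries S)
    (hx : ∀ c, colemanDeltaCoinvFun hπ hq ι u hu γ hreg w hγ ε (x c) =
      (colemanDeltaCoinvFun hπ hq ι u hu γ hreg w hγ ε (unitTwistₗ hπ hq ι u hu γ (v c) (TActModule.ofPS _ _ 1)) * g c - N c) * L)
    (y : ColemanCoordModule hπ hq ι u hu γ) (Nb : PowerSeries S) (a : I) :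
    colemanDeltaCoinvFun hπ hq ι u hu γ hreg w hγ ε (Nb • x a + (unitTwistₗ hπ hq ι u hu γ (v a) (g a • y) - N a • y)) =
      (colemanDeltaCoinvFun hπ hq ι u hu γ hreg w hγ ε (unitTwistₗ hπ hq ι u hu γ (v a) (TActModule.ofPS _ _ 1)) * g a - N a) *
        (Nb * L + colemanDeltaCoinvFun hπ hq ι u hu γ hreg w hγ ε y) :=
  CosetCocycle.apply_conj_eq (colemanDeltaCoinvFun hπ hq ι u hu γ hreg w hγ ε)
    (fun a => unitTwistₗ hπ hq ι u hu γ (v a) ∘ₗ LinearMap.lsmul (PowerSeries S) _ (g a))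
    (fun a => colemanDeltaCoinvFun hπ hq ι u hu γ hreg w hγ ε (unitTwistₗ hπ hq ι u hu γ (v a) (TActModule.ofPS _ _ 1)) * g a) N
    (fun a m => by
      rw [LinearMap.comp_apply, LinearMap.lsmul_apply, colemanDeltaCoinvFun_unitTwistₗ_smul hπ hq ι u hu γ hreg w hγ ε hε])
    x L hx y Nb a

include hε in
/-- ★★★ **The `χ`-averaged elliptic units have `φ_ε = (t_a g_a − N_a)·μ_χ`** with
**`μ_χ = L + Σ_t χ_t·(t_{w_t} h_t)·(N_{b_t} L + φ_ε(y_t))`**, for coset operators `δ_t = σ_{w_t} ∘ (h_t •)` and signs `χ_t` — the one-prime formula for the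
`χ`-part of de Shalit's global measure when `[G:D] > 1`. [cite: deShalit1987, Ch. II §4.12 (29)–(33); Ch. III §1.3, §1.4 (5)] -/
theorem colemanDeltaCoinvFun_add_sum_smul_galTwist_eq {I : Type*} (x : I → ColemanCoordModule hπ hq ι u hu γ) (v : I → 𝒪[F]ˣ)
    (g N : I → PowerSeries S) (L : PowerSeries S)
    (hx : ∀ c, colemanDeltaCoinvFun hπ hq ι u hu γ hreg w hγ ε (x c) =
      (colemanDeltaCoinvFun hπ hq ι u hu γ hreg w hγ ε (unitTwistₗ hπ hq ι u hu γ (v c) (TActModule.ofPS _ _ 1)) * g c - N c) * L)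
    {T : Type*} (𝓣 : Finset T) (wt : T → 𝒪[F]ˣ) (h : T → PowerSeries S) (χ : T → PowerSeries S) (Nb : T → PowerSeries S)
    (y : T → ColemanCoordModule hπ hq ι u hu γ) (a : I) :
    colemanDeltaCoinvFun hπ hq ι u hu γ hreg w hγ ε
        (x a + ∑ t ∈ 𝓣, χ t • unitTwistₗ hπ hq ι u hu γ (wt t) (h t • (Nb t • x a + (unitTwistₗ hπ hq ι u hu γ (v a) (g a • y t) - N a • y t)))) =
      (colemanDeltaCoinvFun hπ hq ι u hu γ hreg w hγ ε (unitTwistₗ hπ hq ι u hu γ (v a) (TActModule.ofPS _ _ 1)) * g a - N a) *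
        (L + ∑ t ∈ 𝓣, χ t * (colemanDeltaCoinvFun hπ hq ι u hu γ hreg w hγ ε (unitTwistₗ hπ hq ι u hu γ (wt t) (TActModule.ofPS _ _ 1)) * h t) *
          (Nb t * L + colemanDeltaCoinvFun hπ hq ι u hu γ hreg w hγ ε (y t))) :=
  CosetCocycle.apply_add_sum_smul_eq (colemanDeltaCoinvFun hπ hq ι u hu γ hreg w hγ ε)
    (fun a => unitTwistₗ hπ hq ι u hu γ (v a) ∘ₗ LinearMap.lsmul (PowerSeries S) _ (g a))
    (fun a => colemanDeltaCoinvFun hπ hq ι u hu γ hreg w hγ ε (unitTwistₗ hπ hq ι u hu γ (v a) (TActModule.ofPS _ _ 1)) * g a) N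
    (fun a m => by
      rw [LinearMap.comp_apply, LinearMap.lsmul_apply, colemanDeltaCoinvFun_unitTwistₗ_smul hπ hq ι u hu γ hreg w hγ ε hε])
    x L hx 𝓣 (fun t => unitTwistₗ hπ hq ι u hu γ (wt t) ∘ₗ LinearMap.lsmul (PowerSeries S) _ (h t))
    (fun t => colemanDeltaCoinvFun hπ hq ι u hu γ hreg w hγ ε (unitTwistₗ hπ hq ι u hu γ (wt t) (TActModule.ofPS _ _ 1)) * h t)
    (fun t m => by
      rw [LinearMap.comp_apply, LinearMap.lsmul_apply, colemanDeltaCoinvFun_unitTwistₗ_smul hπ hq ι u hu γ hreg w hγ ε hε])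
    χ Nb y a

end Coleman

end Literature.NumberTheory.GaloisRepresentations

end
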